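import Mathlib
import HarnessLib
import HarnessLib.Audit
import Summits.CriticalPhenomena.PercolationContinuityZ3.Theorems.PercNearOneGluingNoHeavyLowerTailHexMSMatchBlockers
import Summits.CriticalPhenomena.PercolationContinuityZ3.Theorems.PercNearOneGluingNoHeavyLowerTailHexMSMatchMS2
import Summits.CriticalPhenomena.PercolationContinuityZ3.Theorems.PercNearOneGluingNoHeavyLowerTailHexMSMatchDepthOneMS2
import Summits.CriticalPhenomena.PercolationContinuityZ3.Theorems.PercNearOneGluingNoHeavyLowerTailHexMSMatchTopsSuffice

/-!
# (MATCH*) for depth-one instances with one blocker type and no cross containment — unconditional (hp-7 gen 74)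

Support file for crux `stmt-CriticalPhenomena-4575` (route `PercNearOneGluingNoHeavy`), hull-port seat `prim-hp-7` (generation 74);
`--supports stmt-CriticalPhenomena-4575`.  No `sorry`.  Memo: `run/shared/lean/prim/prim-hp-7/FROM-prim-hp-7-g74-TOPS-SUFFICE.md`.

Gen 72 reduced the depth-one layer of (MATCH*) to the second-order Marica–Schönheim conjecture (MS2)
(`two_mul_card_le_card_clU_scTerms_of_ms2`, `card_le_card_farNbhd_of_ms2`, both CONDITIONAL on `MS2 α`).  Gen 74 proved the
one-type case of (MS2) without cross containment (`TopsSuffice.card_le_card_diffs_union_diffs_of_subset_diffs`, a corollary of the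
two-pool theorem).  This file runs gen 72's two proofs on that unconditional input:

* `two_mul_card_le_card_clU_scTerms_of_oneType` — (Π2″) for dead-like blocks `P, Q` and pure blockers `W ⊆ P \\ Q` (type 5 only)
  contained in no member of `Q`: `2 (#P + #Q + #W) ≤ #cl(scTerms P Q W)`, unconditionally.
* `card_le_card_farNbhd_of_oneType` — Hall for the dead set, `#𝒟 ≤ #(farNbhd 𝒟 x (dead U 𝒟 x))`, for every antipodal instance whose
  dead members have labels in `{i, i+1, i+3, i+4}`, whose alive members are cross differences `p \\ q` (labels `i`, `i+1`; alive label `i+5`)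
  or their complements (label `i+2`), and in which no dead member of label `i+1` contains an alive member of label `i+5`.
  (The mirror case — all blockers of type 2 — follows by the symmetry `(P, Q, W) ↦ (co Q, co P, W)` of the instance; not spelled out.)

The proofs are those of gen 72 with the single use of `MS2 α` replaced; nothing else is changed.
-/

namespace Summit.CriticalPhenomena.PercolationContinuityZ3.Theorems

namespace GeneratedDonors

open Finset FinsetFamily

variable {α : Type*} [DecidableEq α]

section Reduction

variable {U : Finset α}

/-- **The second-difference reduction for ONE blocker type without cross containment — unconditional** (hp-7 gen 74).
For dead-like blocks `P, Q ⊆ U` and blockers `W ⊆ P \\\\ Q` (all of type 5) that are pure (`C2`) and contained in no member of `Q`,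
`2 (#P + #Q + #W) ≤ #cl(scTerms P Q W)`.  Proof: gen 72's reduction verbatim, with the (MS2) instance supplied by
`TopsSuffice.card_le_card_diffs_union_diffs_of_subset_diffs` (the type-2 designated family is empty because `U \\ (q \\ p) ∈ P \\\\ Q`
would force `p' ∪ q = U`). -/
theorem two_mul_card_le_card_clU_scTerms_of_oneType (P Q W : Finset (Finset α))
    (hU : ∀ a ∈ P ∪ Q, a ⊆ U) (hPQ : Disjoint P Q)
    (hint : ∀ a ∈ P ∪ Q, ∀ b ∈ P ∪ Q, (a ∩ b).Nonempty) (hcov : ∀ a ∈ P ∪ Q, ∀ b ∈ P ∪ Q, a ∪ b ≠ U)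
    (hrep : W ⊆ scReps U P Q) (hWco : ∀ a ∈ W, ∀ b ∈ W, a ≠ U \ b)
    (hC2 : ∀ w ∈ W, w ∉ clU U ((P \\ P) ∪ (Q \\ Q)))
    (hone : W ⊆ P \\ Q) (hncc : ∀ q ∈ Q, ∀ w ∈ W, ¬ w ⊆ q) :
    2 * (#P + #Q + #W) ≤ #(clU U (scTerms P Q W)) := by
  classical
  set F := P ∪ Q with hFdef
  set T := scTerms P Q W with hTdef
  have hcardF : #F = #P + #Q := card_union_of_disjoint hPQ
  have hP : ∀ {a}, a ∈ P → a ∈ F := fun ha => mem_union_left _ ha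
  have hQ : ∀ {a}, a ∈ Q → a ∈ F := fun ha => mem_union_right _ ha
  have hcc : ∀ {a : Finset α}, a ⊆ U → U \ (U \ a) = a := fun ha => Finset.sdiff_sdiff_eq_self ha
  have hWU : ∀ w ∈ W, w ⊆ U := fun w hw => subset_of_mem_scReps hU (hrep hw)
  -- the pure cross differences behind W
  set D₅ : Finset (Finset α) := (P \\ Q).filter fun d => d ∈ W with hD₅def
  set D₂ : Finset (Finset α) := (Q \\ P).filter fun d => U \ d ∈ W with hD₂def
  have hD₅ : D₅ ⊆ P \\ Q := filter_subset _ _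
  have hD₂ : D₂ ⊆ Q \\ P := filter_subset _ _
  have hdsubU : ∀ t ∈ (P \\ P) ∪ (Q \\ Q), t ⊆ U := by
    intro t ht
    rcases mem_union.mp ht with ht | ht
    · obtain ⟨a, ha, b, -, rfl⟩ := mem_diffs.mp ht; exact sdiff_subset.trans (hU a (hP ha))
    · obtain ⟨a, ha, b, -, rfl⟩ := mem_diffs.mp ht; exact sdiff_subset.trans (hU a (hQ ha))
  have hpure : ∀ d ∈ D₅ ∪ D₂, d ∉ (P \\ P) ∪ (Q \\ Q) := by
    intro d hd hbad
    rcases mem_union.mp hd with hd | hd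
    · exact hC2 d (mem_filter.mp hd).2 (mem_clU.mpr (Or.inl hbad))
    · exact hC2 _ (mem_filter.mp hd).2 (mem_clU.mpr (Or.inr ⟨d, hbad, rfl⟩))
  -- members are neither cross differences nor their own kind: F, D₅, D₂ pairwise disjoint
  have hFD : ∀ d ∈ D₅ ∪ D₂, d ∉ F := by
    intro d hd hdF
    have : d ∈ F \\ F := by
      rcases mem_union.mp hd with hd | hd
      · obtain ⟨a, ha, b, hb, rfl⟩ := mem_diffs.mp (hD₅ hd); exact sdiff_mem_diffs (hP ha) (hQ hb)
      · obtain ⟨a, ha, b, hb, rfl⟩ := mem_diffs.mp (hD₂ hd); exact sdiff_mem_diffs (hQ ha) (hP hb)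
    exact notMem_clU_diffs_of_mem hU hint hcov hdF (mem_clU.mpr (Or.inl this))
  have h52 : Disjoint D₅ D₂ := by
    rw [Finset.disjoint_left]
    intro d h5 h2
    have hw : d ∈ W := (mem_filter.mp h5).2
    have hw' : U \ d ∈ W := (mem_filter.mp h2).2
    exact hWco _ hw' _ hw rfl
  -- #W ≤ #D₅ + #D₂ : w ↦ (w if w ∈ P \\ Q else U \ w)
  have hWD : #W ≤ #(D₅ ∪ D₂) := by
    refine card_le_card_of_injOn (fun w => if w ∈ P \\ Q then w else U \ w) ?_ ?_
    · intro w hw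
      have hw' := hrep (mem_coe.mp hw)
      simp only [mem_coe]
      by_cases hwd : w ∈ P \\ Q
      · rw [if_pos hwd]; exact mem_union_left _ (mem_filter.mpr ⟨hwd, mem_coe.mp hw⟩)
      · rw [if_neg hwd]
        unfold scReps at hw'
        rcases mem_union.mp hw' with h | h
        · exact absurd h hwd
        · obtain ⟨pq, hpq, hpqw⟩ := mem_image.mp h
          obtain ⟨hp₀, hq₀⟩ := mem_product.mp hpq
          have hq₀U : pq.2 ⊆ U := hU _ (hQ hq₀)
          have he_eq : U \ w = pq.2 \ pq.1 := by
            rw [← hpqw]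
            ext i; simp only [mem_sdiff, mem_union]
            constructor
            · rintro ⟨hiU, h⟩
              refine ⟨?_, fun h1 => h (Or.inl h1)⟩
              by_contra h2; exact h (Or.inr ⟨hiU, h2⟩)
            · rintro ⟨hi2, hi1⟩
              exact ⟨hq₀U hi2, fun h => h.elim hi1 (fun h' => h'.2 hi2)⟩
          refine mem_union_right _ (mem_filter.mpr ⟨?_, ?_⟩)
          · rw [he_eq]; exact sdiff_mem_diffs hq₀ hp₀
          · rw [hcc (hWU w (mem_coe.mp hw))]; exact mem_coe.mp hw
    · intro w hw w' hw' hww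
      simp only at hww
      have hwU := hWU w (mem_coe.mp hw); have hw'U := hWU w' (mem_coe.mp hw')
      by_cases h1 : w ∈ P \\ Q <;> by_cases h2 : w' ∈ P \\ Q
      · rwa [if_pos h1, if_pos h2] at hww
      · rw [if_pos h1, if_neg h2] at hww
        exact absurd hww (hWco w (mem_coe.mp hw) w' (mem_coe.mp hw'))
      · rw [if_neg h1, if_pos h2] at hww
        exact absurd hww.symm (hWco w' (mem_coe.mp hw') w (mem_coe.mp hw))
      · rw [if_neg h1, if_neg h2] at hww
        rw [← hcc hwU, hww, hcc hw'U]
  -- (MS2)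
  -- the (MS2) instance, here unconditional: `D₂ = ∅` and the one-type corollary of the two-pool theorem
  have hD₂e : D₂ = ∅ := by
    refine filter_eq_empty_iff.mpr ?_
    intro d hd hdW
    obtain ⟨q, hq, p, -, rfl⟩ := mem_diffs.mp hd
    obtain ⟨p', hp', q', -, he⟩ := mem_diffs.mp (hone hdW)
    -- `p' \ q' = U \ (q \ p)` contains `U \ q`, so `p' ∪ q = U`
    refine hcov p' (hP hp') q (hQ hq) (Subset.antisymm (union_subset (hU p' (hP hp')) (hU q (hQ hq))) ?_)
    intro i hiU
    rw [mem_union]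
    by_cases hiq : i ∈ q
    · exact Or.inr hiq
    · have hi : i ∈ U \ (q \ p) := mem_sdiff.mpr ⟨hiU, fun h => hiq (mem_sdiff.mp h).1⟩
      rw [← he] at hi
      exact Or.inl (mem_sdiff.mp hi).1
  have hncc' : ∀ q ∈ Q, ∀ d ∈ D₅, ¬ d ⊆ q := fun q hq d hd => hncc q hq d (mem_filter.mp hd).2
  have hms2 : #((P ∪ Q) ∪ D₅ ∪ D₂) ≤ #(((P ∪ Q) \\ (P ∪ Q)) ∪ (P \\ D₅) ∪ (Q \\ D₂)) := by
    -- the one-type corollary of the two-pool theorem (`TopsSuffice`), re-derived here for the designated family `D₅ \ F`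
    have hD₅F : Disjoint (P ∪ Q) (D₅ \ (P ∪ Q)) := disjoint_sdiff
    have hsplitU : (P ∪ Q) ∪ D₅ = (P ∪ Q) ∪ (D₅ \ (P ∪ Q)) := by rw [union_sdiff_self_eq_union]
    have h0 : #(P ∪ Q) + #(D₅ \ (P ∪ Q)) ≤ #(((P ∪ Q) \\ (P ∪ Q)) ∪ (P \\ D₅)) := by
      refine TopsSuffice.card_add_card_le_card_of_two_pools (P ∪ Q) P (P ∪ Q) (D₅ \ (P ∪ Q)) _
        subset_union_left subset_rfl hD₅F ?_ ?_ subset_union_left ?_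
      · intro d hd
        obtain ⟨p, hp, q, -, rfl⟩ := mem_diffs.mp (hD₅ (mem_sdiff.mp hd).1)
        exact ⟨p, hp, sdiff_subset⟩
      · rintro b hb ⟨c, hc, hcb⟩
        rcases mem_union.mp hb with hbP | hbQ
        · exact hbP
        · exact absurd hcb (hncc' b hbQ c (mem_sdiff.mp hc).1)
      · exact (diffs_subset_left sdiff_subset).trans subset_union_right
    rw [hD₂e, union_empty, Finset.diffs_empty, union_empty, hsplitU, card_union_of_disjoint hD₅F]
    exact h0
  set T₀ := (F \\ F) ∪ (P \\ D₅) ∪ (Q \\ D₂) with hT₀def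
  have hcount : #F + #W ≤ #T₀ := by
    have hFD' : Disjoint F (D₅ ∪ D₂) := Finset.disjoint_right.mpr fun d hd => hFD d hd
    have e1 : #(F ∪ D₅ ∪ D₂) = #F + (#D₅ + #D₂) := by
      rw [union_assoc, card_union_of_disjoint hFD', card_union_of_disjoint h52]
    have e2 : #(D₅ ∪ D₂) = #D₅ + #D₂ := card_union_of_disjoint h52
    have := hms2
    rw [e1] at this
    omega
  -- T₀ ⊆ T, below members, hence disjoint from its complements
  have hT₀T : T₀ ⊆ T := by
    intro t ht
    rw [hTdef]; unfold scTerms; simp only [mem_union]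
    rcases mem_union.mp ht with ht | ht
    · rcases mem_union.mp ht with ht | ht
      · obtain ⟨a, ha, b, hb, rfl⟩ := mem_diffs.mp ht
        rcases mem_union.mp ha with ha | ha <;> rcases mem_union.mp hb with hb | hb
        · exact Or.inl (Or.inl (Or.inl (Or.inl (Or.inl (Or.inl (Or.inl (sdiff_mem_diffs ha hb)))))))
        · exact Or.inl (Or.inl (Or.inl (Or.inl (Or.inl (Or.inr (sdiff_mem_diffs ha hb))))))
        · exact Or.inl (Or.inl (Or.inl (Or.inl (Or.inr (sdiff_mem_diffs ha hb)))))
        · exact Or.inl (Or.inl (Or.inl (Or.inl (Or.inl (Or.inl (Or.inr (sdiff_mem_diffs ha hb)))))))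
      · obtain ⟨p, hp, d, hd, rfl⟩ := mem_diffs.mp ht
        exact Or.inl (Or.inl (Or.inl (Or.inr (mem_diffs.mpr ⟨p, hp, d, (mem_filter.mp hd).2, rfl⟩))))
    · obtain ⟨q, hq, d, hd, rfl⟩ := mem_diffs.mp ht
      refine Or.inl (Or.inr (mem_infs.mpr ⟨q, hq, U \ d, (mem_filter.mp hd).2, ?_⟩))
      show q ∩ (U \ d) = q \ d
      ext i; simp only [mem_inter, mem_sdiff]
      constructor
      · rintro ⟨hiq, -, hid⟩; exact ⟨hiq, hid⟩
      · rintro ⟨hiq, hid⟩; exact ⟨hiq, hU q (hQ hq) hiq, hid⟩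
  have hbelow : ∀ t ∈ T₀, ∃ f ∈ F, t ⊆ f := by
    intro t ht
    rcases mem_union.mp ht with ht | ht
    · rcases mem_union.mp ht with ht | ht
      · obtain ⟨a, ha, b, -, rfl⟩ := mem_diffs.mp ht; exact ⟨a, ha, sdiff_subset⟩
      · obtain ⟨p, hp, d, -, rfl⟩ := mem_diffs.mp ht; exact ⟨p, hP hp, sdiff_subset⟩
    · obtain ⟨q, hq, d, -, rfl⟩ := mem_diffs.mp ht; exact ⟨q, hQ hq, sdiff_subset⟩
  set Tc := T₀.image fun t => U \ t with hTcdef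
  have hcardTc : #Tc = #T₀ := by
    refine card_image_of_injOn ?_
    intro t ht t' ht' htt
    obtain ⟨f, hf, htf⟩ := hbelow t (mem_coe.mp ht)
    obtain ⟨f', hf', htf'⟩ := hbelow t' (mem_coe.mp ht')
    simp only at htt
    rw [← hcc (htf.trans (hU f hf)), htt, hcc (htf'.trans (hU f' hf'))]
  have hdisj : Disjoint T₀ Tc := by
    rw [Finset.disjoint_left]
    intro t ht htc
    obtain ⟨t', ht', htt⟩ := mem_image.mp htc
    obtain ⟨f, hf, htf⟩ := hbelow t ht
    obtain ⟨f', hf', htf'⟩ := hbelow t' ht'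
    apply hcov f hf f' hf'
    apply Subset.antisymm (union_subset (hU f hf) (hU f' hf'))
    intro i hiU
    rw [mem_union]
    by_cases hif' : i ∈ t'
    · exact Or.inr (htf' hif')
    · have : i ∈ U \ t' := mem_sdiff.mpr ⟨hiU, hif'⟩
      rw [htt] at this
      exact Or.inl (htf this)
  have hbig : T₀ ∪ Tc ⊆ clU U T := by
    intro t ht
    rcases mem_union.mp ht with ht | ht
    · exact mem_clU.mpr (Or.inl (hT₀T ht))
    · obtain ⟨t', ht', rfl⟩ := mem_image.mp ht
      exact mem_clU.mpr (Or.inr ⟨t', hT₀T ht', rfl⟩)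
  have := card_le_card hbig
  rw [card_union_of_disjoint hdisj, hcardTc] at this
  omega


end Reduction

section Bridge

variable {U : Finset α} {𝒟 : Finset (Finset α)} {x : Finset α → ZMod 6}

/-- **(MATCH*) for depth-one instances with ONE blocker type and no cross containment — unconditional** (hp-7 gen 74).
Every antipodal instance whose dead members carry labels in `{i, i+1, i+3, i+4}`, whose alive members are cross differences `p \\ q`
of dead members of labels `i, i+1` (label `i+5`) or their complements (label `i+2`), and in which no dead member of label `i+1`
contains an alive member of label `i+5`, satisfies `#𝒟 ≤ #(farNbhd 𝒟 x (dead U 𝒟 x))` (Hall for the dead set).  Proof: gen 72's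
bridge verbatim on top of `two_mul_card_le_card_clU_scTerms_of_oneType`. -/
theorem card_le_card_farNbhd_of_oneType (hU : ∀ a ∈ 𝒟, a ⊆ U) (hco : ∀ a ∈ 𝒟, U \ a ∈ 𝒟)
    (hanti : ∀ a ∈ 𝒟, x (U \ a) = x a + 3) (i : ZMod 6)
    (hlab : ∀ a ∈ dead U 𝒟 x, x a = i ∨ x a = i + 1 ∨ x a = i + 3 ∨ x a = i + 4)
    (hdepth : ∀ d ∈ 𝒟, d ∉ dead U 𝒟 x →
      (x d = i + 5 ∧ d ∈ ((dead U 𝒟 x).filter fun a => x a = i) \\ ((dead U 𝒟 x).filter fun a => x a = i + 1)) ∨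
      (x d = i + 2 ∧ U \ d ∈ ((dead U 𝒟 x).filter fun a => x a = i) \\ ((dead U 𝒟 x).filter fun a => x a = i + 1)))
    (hncc : ∀ q ∈ dead U 𝒟 x, x q = i + 1 → ∀ d ∈ 𝒟, d ∉ dead U 𝒟 x → x d = i + 5 → ¬ d ⊆ q) :
    #𝒟 ≤ #(farNbhd 𝒟 x (dead U 𝒟 x)) := by
  classical
  obtain ⟨n01, n30, n31, n40, n41, n85, n50, n51, n20, n21, n25, n53, n54, e33, e43, e23⟩ := label_facts i
  set P : Finset (Finset α) := (dead U 𝒟 x).filter fun a => x a = i with hPdef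
  set Q : Finset (Finset α) := (dead U 𝒟 x).filter fun a => x a = i + 1 with hQdef
  set W : Finset (Finset α) := (𝒟 \ dead U 𝒟 x).filter fun a => x a = i + 5 with hWdef
  have hP : ∀ p ∈ P, p ∈ dead U 𝒟 x ∧ x p = i := fun p hp => by
    have h := mem_filter.mp hp; exact ⟨h.1, h.2⟩
  have hQ : ∀ q ∈ Q, q ∈ dead U 𝒟 x ∧ x q = i + 1 := fun q hq => by
    have h := mem_filter.mp hq; exact ⟨h.1, h.2⟩
  have hW : ∀ w ∈ W, (w ∈ 𝒟 ∧ w ∉ dead U 𝒟 x) ∧ x w = i + 5 := fun w hw => by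
    have h := mem_filter.mp hw; exact ⟨mem_sdiff.mp h.1, h.2⟩
  have hdD : ∀ {a}, a ∈ dead U 𝒟 x → a ∈ 𝒟 := fun ha => (mem_filter.mp ha).1
  have hcc : ∀ {a}, a ⊆ U → U \ (U \ a) = a := fun ha => Finset.sdiff_sdiff_eq_self ha
  -- the hypotheses of the pure inequality for (P, Q, W)
  have h1 : ∀ a ∈ P ∪ Q, a ⊆ U := by
    intro a ha
    rcases mem_union.mp ha with ha | ha
    · exact hU a (hdD (hP a ha).1)
    · exact hU a (hdD (hQ a ha).1)
  have h2 : Disjoint P Q := by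
    rw [Finset.disjoint_left]
    intro a haP haQ
    exact n01 ((hP a haP).2.symm.trans (hQ a haQ).2)
  have hPQlab : ∀ a ∈ P ∪ Q, a ∈ dead U 𝒟 x ∧ (x a = i ∨ x a = i + 1) := by
    intro a ha
    rcases mem_union.mp ha with ha | ha
    · exact ⟨(hP a ha).1, Or.inl (hP a ha).2⟩
    · exact ⟨(hQ a ha).1, Or.inr (hQ a ha).2⟩
  -- dead-like: pairwise intersecting and non-covering (labels i, i+1 are close)
  have hint : ∀ a ∈ P ∪ Q, ∀ b ∈ P ∪ Q, (a ∩ b).Nonempty := fun a ha b hb =>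
    inter_nonempty_of_dead_of_close (hPQlab a ha).1 (hdD (hPQlab b hb).1)
      (close_of_mem_pair (hPQlab a ha).2 (hPQlab b hb).2)
  have hcov : ∀ a ∈ P ∪ Q, ∀ b ∈ P ∪ Q, a ∪ b ≠ U := fun a ha b hb =>
    union_ne_of_dead_of_close hU hco hanti (hPQlab a ha).1 (hdD (hPQlab b hb).1)
      (close_of_mem_pair (hPQlab a ha).2 (hPQlab b hb).2)
  have hone : W ⊆ P \\ Q := by
    intro w hw
    obtain ⟨⟨hwD, hwa⟩, hxw⟩ := hW w hw
    rcases hdepth w hwD hwa with ⟨-, h⟩ | ⟨h2', -⟩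
    · exact h
    · exact absurd (hxw.symm.trans h2') n25.symm
  have h4 : W ⊆ scReps U P Q := fun w hw => by
    unfold scReps; exact mem_union_left _ (hone hw)
  have hncc' : ∀ q ∈ Q, ∀ w ∈ W, ¬ w ⊆ q := by
    intro q hq w hw
    obtain ⟨⟨hwD, hwa⟩, hxw⟩ := hW w hw
    exact hncc q (hQ q hq).1 (hQ q hq).2 w hwD hwa hxw
  have h5 : ∀ a ∈ W, ∀ b ∈ W, a ≠ U \ b := by
    intro a ha b hb hab
    have hxa := (hW a ha).2
    have hxb : x a = x b + 3 := by rw [hab]; exact hanti b (hW b hb).1.1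
    rw [(hW b hb).2] at hxb
    exact n85 (hxb.symm.trans hxa)
  have h6 : ∀ w ∈ W, w ∉ clU U ((P \\ P) ∪ (Q \\ Q)) := by
    intro w hw hmem
    obtain ⟨⟨hwD, -⟩, -⟩ := hW w hw
    have key : ∀ t ∈ (P \\ P) ∪ (Q \\ Q), t ∉ 𝒟 ∧ t ⊆ U := by
      intro t ht
      rcases mem_union.mp ht with ht | ht
      · obtain ⟨a, ha, b, hb, rfl⟩ := mem_diffs.mp ht
        have hda := hP a ha; have hdb := hP b hb
        refine ⟨(sdiff_notMem_of_dead_of_label_eq hU hco hanti (hdD hda.1) (hdD hdb.1) (mem_filter.mp hda.1).2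
          (mem_filter.mp hdb.1).2 (hda.2.trans hdb.2.symm)).2, sdiff_subset.trans (hU a (hdD hda.1))⟩
      · obtain ⟨a, ha, b, hb, rfl⟩ := mem_diffs.mp ht
        have hda := hQ a ha; have hdb := hQ b hb
        refine ⟨(sdiff_notMem_of_dead_of_label_eq hU hco hanti (hdD hda.1) (hdD hdb.1) (mem_filter.mp hda.1).2
          (mem_filter.mp hdb.1).2 (hda.2.trans hdb.2.symm)).2, sdiff_subset.trans (hU a (hdD hda.1))⟩
    rcases mem_clU.mp hmem with h | ⟨t, ht, rfl⟩
    · exact (key w h).1 hwD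
    · have := hco _ hwD
      rw [hcc (key t ht).2] at this
      exact (key t ht).1 this
  -- the pure inequality (unconditional here), and the embedding of the terms
  have hineq : 2 * (#P + #Q + #W) ≤ #(clU U (scTerms P Q W)) :=
    two_mul_card_le_card_clU_scTerms_of_oneType P Q W h1 h2 hint hcov h4 h5 h6 hone hncc'
  have hsub : clU U (scTerms P Q W) ⊆ farNbhd 𝒟 x (dead U 𝒟 x) :=
    clU_scTerms_subset_farNbhd hU hco hanti i hP hQ (fun w hw => ⟨(hW w hw).1.1, (hW w hw).2⟩)
  -- counting 𝒟: every member or its complement lies in P ∪ Q ∪ W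
  set A : Finset (Finset α) := 𝒟.filter fun d => x d = i ∨ x d = i + 1 ∨ x d = i + 5 with hAdef
  set B : Finset (Finset α) := 𝒟.filter fun d => ¬ (x d = i ∨ x d = i + 1 ∨ x d = i + 5) with hBdef
  have hmemPQW : ∀ d ∈ 𝒟, (x d = i ∨ x d = i + 1 ∨ x d = i + 5) → d ∈ P ∪ Q ∪ W := by
    intro d hd hx
    simp only [mem_union]
    by_cases hdead : d ∈ dead U 𝒟 x
    · rcases hx with h | h | h
      · exact Or.inl (Or.inl (mem_filter.mpr ⟨hdead, h⟩))
      · exact Or.inl (Or.inr (mem_filter.mpr ⟨hdead, h⟩))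
      · exfalso
        rcases hlab d hdead with h' | h' | h' | h'
        · exact n50 (h.symm.trans h')
        · exact n51 (h.symm.trans h')
        · exact n53 (h.symm.trans h')
        · exact n54 (h.symm.trans h')
    · rcases hdepth d hd hdead with ⟨h5', -⟩ | ⟨h2', -⟩
      · exact Or.inr (mem_filter.mpr ⟨mem_sdiff.mpr ⟨hd, hdead⟩, h5'⟩)
      · exfalso
        rcases hx with h | h | h
        · exact n20 (h2'.symm.trans h)
        · exact n21 (h2'.symm.trans h)
        · exact n25 (h2'.symm.trans h)
  have hA : A ⊆ P ∪ Q ∪ W := fun d hd => hmemPQW d (mem_filter.mp hd).1 (mem_filter.mp hd).2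
  have hB : B.image (fun d => U \ d) ⊆ P ∪ Q ∪ W := by
    intro e he
    obtain ⟨d, hd, rfl⟩ := mem_image.mp he
    obtain ⟨hdD', hnot⟩ := mem_filter.mp hd
    refine hmemPQW (U \ d) (hco d hdD') ?_
    rw [hanti d hdD']
    by_cases hdead : d ∈ dead U 𝒟 x
    · rcases hlab d hdead with h | h | h | h
      · exact absurd (Or.inl h) hnot
      · exact absurd (Or.inr (Or.inl h)) hnot
      · rw [h]; exact Or.inl e33
      · rw [h]; exact Or.inr (Or.inl e43)
    · rcases hdepth d hdD' hdead with ⟨h5', -⟩ | ⟨h2', -⟩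
      · exact absurd (Or.inr (Or.inr h5')) hnot
      · rw [h2']; exact Or.inr (Or.inr e23)
  have hinjB : Set.InjOn (fun d : Finset α => U \ d) ↑B := by
    intro d hd e he hde
    have hdU : d ⊆ U := hU d (mem_filter.mp (mem_coe.mp hd)).1
    have heU : e ⊆ U := hU e (mem_filter.mp (mem_coe.mp he)).1
    have h1' := congrArg (fun t => U \ t) hde
    simp only [hcc hdU, hcc heU] at h1'
    exact h1'
  have hsplit : #A + #B = #𝒟 := card_filter_add_card_filter_not _
  have hcardA : #A ≤ #(P ∪ Q ∪ W) := card_le_card hA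
  have hcardB : #B ≤ #(P ∪ Q ∪ W) := by
    rw [← card_image_of_injOn hinjB]; exact card_le_card hB
  have hunion : #(P ∪ Q ∪ W) ≤ #P + #Q + #W :=
    (card_union_le _ _).trans (Nat.add_le_add_right (card_union_le _ _) _)
  have hT := card_le_card hsub
  omega


end Bridge

end GeneratedDonors

end Summit.CriticalPhenomena.PercolationContinuityZ3.Theorems
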